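import Literature.NumberTheory.Transcendental.KZSemiCanonicalReductionProofs
import Summits.KontsevichZagierPeriods.KontsevichZagierPeriods.Theses.ScissorsTransport

/-!
# Route ScissorsTransport — support item `DifferenceOfVolumes` (stmt-KontsevichZagierPeriods-2670)

Every integral representation `[σ, f]` of dimension `n` is, modulo the moves of the fixed KZ
calculus (`KZ.relations`), a difference `[U₊] − [U₋]` of two INTEGRAND-`1` representations of
dimension `n + 1` (Viu-Sos' reduction "every real period is a difference of two volumes of
`ℚ`-semialgebraic sets", performed inside the rules; finite volume suffices, no compactness):

* split `σ = σ₊ ⊔ σ₋` by the sign of `f` (rule (1a); `σ₋ = {f < 0}` is `ℚ`-semialgebraic by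
  Tarski–Seidenberg, `IsSemialgebraicFunOn.isSemialgebraic_sep_lt`);
* flip the sign on the negative piece: `[σ₋, f] + [σ₋, −f] ∈ relations`
  (`KZ.of_add_of_neg_mem_levelRel`, `KZ.levelRel_le_relations`);
* the regions under the graphs of the two non-negative integrands `f|σ₊`, `−f|σ₋` are one
  Newton–Leibniz move away each (`KZ.exists_underGraph`: band `{(x,t) | x ∈ τ, 0 ≤ t ≤ g x}`,
  integrand `1`, primitive `F (x, t) = t`; absolute convergence by Tonelli, `vol = ∫ g < ∞`).

This is `KZ.exists_sub_of_isBounded` of `KZSemiCanonicalReductionProofs.lean` with its two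
boundedness hypotheses removed (there they only serve to make the bands bounded, which the route
item does not ask for).

Sources: J. Viu-Sos, *A semi-canonical reduction for periods of Kontsevich–Zagier*,
Int. J. Number Theory 17 (2021), Thm. 1.1 / Cor. 2.3; J. Cresson, J. Viu-Sos, arXiv:1912.01751, §2.2;
M. Kontsevich, D. Zagier, *Periods* (2001), §1.1–1.2. Deliberately NOT here: boundedness /
compactness of the two volumes (see `KZ.exists_sub_of_isBounded` and Viu-Sos' step (b)).
-/

namespace Summit.KontsevichZagierPeriods.ScissorsTransport

open Set MeasureTheory
open Literature.NumberTheory.Transcendental Literature.NumberTheory.Transcendental.KZ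
open Literature.ModelTheory.ExponentialFields

/-- **Difference of volumes, pointwise form.** For every integral representation `r = [σ, f]` of
dimension `n` there are representations `A`, `B` of dimension `n + 1` with integrand `1` on their
domains such that `[r] − ([A] − [B]) ∈ KZ.relations`: split `σ` by the sign of `f` (rule (1a)),
flip the sign on `{f < 0}` (`[σ₋, f] + [σ₋, −f]` is a relation), and take the regions under the two
graphs (`KZ.exists_underGraph`, one Newton–Leibniz move each). This is
`KZ.exists_sub_of_isBounded` without its boundedness hypotheses.
[Viu-Sos 2021, Thm. 1.1 / Cor. 2.3; Kontsevich–Zagier 2001, §1.2] -/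
theorem exists_sub_integrand_one {n : ℕ} (r : IntegralRep n) :
    ∃ A B : IntegralRep (n + 1),
      (∀ z ∈ A.domain, A.integrand z = 1) ∧ (∀ z ∈ B.domain, B.integrand z = 1) ∧
      of r - (of A - of B) ∈ relations := by
  -- the sign pieces
  have hTms : IsSemialgebraic ℚ {x | x ∈ r.domain ∧ r.integrand x < 0} := by
    simpa using r.isSemialgebraicFunOn_integrand.isSemialgebraic_sep_lt
      Literature.ModelTheory.ExponentialFields.tarski_seidenberg_real_holds 0 0
  have hTps : IsSemialgebraic ℚ (r.domain \ {x | x ∈ r.domain ∧ r.integrand x < 0}) :=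
    r.isSemialgebraic_domain.diff hTms
  set r₁ := r.restrict _ hTps sdiff_subset with hr₁
  set r₂ := r.restrict _ hTms (fun x hx => hx.1) with hr₂
  -- [r] ≡ [r₁] + [r₂]
  have e1 : of r - of r₁ - of r₂ ∈ relations := by
    refine domainAddRel_subset_relations ⟨n, r, r₁, r₂, ?_, ?_, fun _ _ => rfl, fun _ _ => rfl, rfl⟩
    · rw [hr₁, hr₂, IntegralRep.domain_restrict, IntegralRep.domain_restrict,
        sdiff_union_of_subset fun x hx => hx.1]
    · rw [hr₁, hr₂, IntegralRep.domain_restrict, IntegralRep.domain_restrict,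
        show (r.domain \ {x | x ∈ r.domain ∧ r.integrand x < 0}) ∩
          {x | x ∈ r.domain ∧ r.integrand x < 0} = ∅ from
          Set.disjoint_iff_inter_eq_empty.mp disjoint_sdiff_left, measure_empty]
  -- signs on the pieces
  have hpos : ∀ x ∈ r₁.domain, 0 ≤ r₁.integrand x := fun x hx => by
    rw [hr₁, IntegralRep.integrand_restrict]
    by_contra h
    exact hx.2 ⟨hx.1, lt_of_not_ge h⟩
  have hneg : ∀ x ∈ r₂.neg.domain, 0 ≤ r₂.neg.integrand x := fun x hx => by
    rw [IntegralRep.integrand_neg, Pi.neg_apply, hr₂, IntegralRep.integrand_restrict, neg_nonneg]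
    exact le_of_lt hx.2
  -- the regions under the graphs
  obtain ⟨A, -, hAi, hA⟩ := exists_underGraph r₁ hpos
  obtain ⟨B, -, hBi, hB⟩ := exists_underGraph r₂.neg hneg
  refine ⟨A, B, fun z _ => by rw [hAi], fun z _ => by rw [hBi], ?_⟩
  have e2 : of r₂ + of r₂.neg ∈ relations :=
    levelRel_le_relations (of_add_of_neg_mem_levelRel r₂)
  have : of r - (of A - of B) = (of r - of r₁ - of r₂) - (of A - of r₁) + (of r₂ + of r₂.neg) +
      (of B - of r₂.neg) := by abel
  rw [this]
  exact relations.add_mem (relations.add_mem (relations.sub_mem e1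
    (newtonLeibnizRel_subset_relations hA)) e2) (newtonLeibnizRel_subset_relations hB)

/-- **Route ScissorsTransport, support item `DifferenceOfVolumes` (stmt-KontsevichZagierPeriods-2670).**
Every representation `[σ, f]` of dimension `n` is, modulo the moves, a difference `[U₊] − [U₋]` of
two integrand-`1` representations of dimension `n + 1` — the route declaration, read through its
definition, is `exists_sub_integrand_one`.
[Viu-Sos 2021, Thm. 1.1 / Cor. 2.3; Cresson–Viu-Sos 2022, §2.2] -/
theorem DifferenceOfVolumes_proof :
    Summit.KontsevichZagierPeriods.KontsevichZagierPeriods.Theses.ScissorsTransport.DifferenceOfVolumes := by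
  unfold Summit.KontsevichZagierPeriods.KontsevichZagierPeriods.Theses.ScissorsTransport.DifferenceOfVolumes
  intro n r
  exact exists_sub_integrand_one r

end Summit.KontsevichZagierPeriods.ScissorsTransport
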